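import Literature.Geometry.Kaehler.StrataGermDescent
import Literature.Geometry.Manifold.DeRhamComparisonTheta
import Literature.Geometry.Manifold.DeRhamFundamentalClassPairing
import Literature.AlgebraicTopology.SingularHomology.GysinMapSupportProofs
import Literature.AlgebraicGeometry.HodgeTheory.RealStructureSingular
import Literature.AlgebraicGeometry.Motives.HodgeDecompositionIsInternalDischarge
import Literature.AlgebraicGeometry.Motives.HodgeDecompositionHarmonicRepresentativeProofs
import HarnessLib

/-!
# Classes dying on the strata of a normal-crossing configuration die near their union

Topic `Literature/Geometry/Kaehler`. The compact-Kähler form of P. Deligne, *Théorie de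
Hodge III* (1974), Prop. 8.2.7 / Cor. 8.2.8 for an embedded strata system
(`StrataDDbarDescent.StrataMaps`: compact Kähler strata `P I` embedded in a compact Kähler manifold
`M`, the stratum of a finite set of indices being the intersection of the strata of its members —
the analytic shadow of the iterated intersections of the components of a simple normal crossing
divisor):

* `StrataMaps.exists_isOpen_map_subtypeVal_eq_zero_real` / `…_complex` — **a class
  `u ∈ Hⁿ(M; ℝ)` (resp. `Hⁿ(M; ℂ)`) whose pull-back to every stratum `P {i}` vanishes vanishes on
  an open neighbourhood of `⋃ i, emb(P {i})`.**

Proof (the "principle of two types", P. Deligne, Ph. Griffiths, J. Morgan, D. Sullivan (1975),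
§§5–6): write `u = e_M[γ]` by de Rham's theorem (`integrationDeRhamIsoFamily`, natural for the
`C^∞` maps `emb {i}`), so that `emb_i^* γ` is exact on every `P {i}`; Hodge-decompose
`γ ⊗ 1 = Σ_{p+q=n} ω_{p,q} + dβ` on `M` (`Motives.isInternal_hodgePQ_holds`); by the Hodge
decomposition of the `P {i}` each `emb_i^* ω_{p,q}` is exact, hence (`StrataGermDescent`: the
`∂∂̄`-descent on the strata and the germ Čech descent) `ω_{p,q}` is exact near the union of the
strata (for `p = 0` or `q = 0` the restrictions even vanish, Voisin (2002), Prop. 6.17); so `γ` is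
exact near the union, and the singular class `e_M[γ]` dies there (de Rham's theorem on open
subsets, `localDeRhamToSubset`, compared with the global one through `Θ⁻¹`,
`thetaInv_deRhamComparisonIso`). Complex classes: real and imaginary parts
(`RealStructureSingular`). Everything is proved; no named facts (D-0026).

## References

* [DeligneHodgeIII1974] P. Deligne, *Théorie de Hodge III*, Publ. Math. IHÉS 44 (1974), Prop. 8.2.7,
  Cor. 8.2.8 (p. 40).
* [DeligneGriffithsMorganSullivan1975] P. Deligne, Ph. Griffiths, J. Morgan, D. Sullivan, *Real
  homotopy theory of Kähler manifolds*, Invent. Math. 29 (1975), §§5–6.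
* [VoisinHodgeI2002] C. Voisin, *Hodge Theory and Complex Algebraic Geometry I* (2002), §6.1.3,
  Prop. 6.17.
* [Bredon1993] G. E. Bredon, *Topology and Geometry*, GTM 139 (1993), Thm. V.9.5.
-/

noncomputable section

-- see "Implementation notes" in `…SingularHomology.SingularChainsConcrete`
set_option backward.isDefEq.respectTransparency false

open scoped Manifold ContDiff Topology
open Set Function Literature.Geometry.Manifold Literature.NumberTheory.Transcendental
open Literature.AlgebraicTopology.SingularHomology CategoryTheory
open _root_.Topology

universe u

namespace Literature.Geometry.Kaehler

/-! ### §1 Local exactness: real parts, restriction, sums -/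

section LocalExact

variable {E : Type*} [NormedAddCommGroup E] [NormedSpace ℂ E]
  {M : Type*} [TopologicalSpace M] [ChartedSpace E M] [IsManifold 𝓘(ℝ, E) ∞ M]

/-- The real part of a complex form exact on an open `V` is exact on `V`. [cite: Wells1980, Ch. II §1] -/
theorem re_mem_localExactForms {n : ℕ} {V : Set M} (hV : IsOpen V) {α : MForm 𝓘(ℝ, E) M ℂ n}
    (hα : α ∈ localExactForms 𝓘(ℝ, E) ℂ hV n) : α.re ∈ localExactForms 𝓘(ℝ, E) ℝ hV n := by
  cases n with
  | zero =>
    change α ∈ (⊥ : Submodule ℝ _) at hα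
    change α.re ∈ (⊥ : Submodule ℝ _)
    rw [Submodule.mem_bot] at hα ⊢
    rw [hα, MForm.re_zero]
  | succ n =>
    obtain ⟨g, hg⟩ := (mem_localExactForms_succ_iff hV).1 hα
    rw [mem_localExactForms_succ_iff]
    refine ⟨⟨(g : MForm 𝓘(ℝ, E) M ℂ n).re, re_mem_smoothFormsOn g.2⟩, ?_⟩
    rw [coe_localD]
    funext x
    by_cases hx : x ∈ V
    · have := congrFun hg x
      rw [coe_localD, MForm.restr_apply_of_mem _ hx] at this
      rw [MForm.restr_apply_of_mem _ hx]
      change mextDeriv (g : MForm 𝓘(ℝ, E) M ℂ n).re x = α.re x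
      rw [← Literature.AlgebraicGeometry.HodgeTheory.re_mextDeriv_apply_of_smoothAt (g.2.1 x hx)]
      change Complex.reCLM.compContinuousAlternatingMap (mextDeriv (g : MForm 𝓘(ℝ, E) M ℂ n) x) =
        Complex.reCLM.compContinuousAlternatingMap (α x)
      rw [this]
    · rw [MForm.restr_apply_of_notMem _ hx]
      have : α x = 0 := by
        have h2 := (localExactForms_le_localClosedForms hV hα).1.2 x hx
        exact h2
      change (0 : _) = Complex.reCLM.compContinuousAlternatingMap (α x)
      rw [this]; ext v; simp

/-- Exactness on an open set restricts to smaller open sets. [folklore] -/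
theorem restr_mem_localExactForms_of_subset {F : Type*} [NormedAddCommGroup F] [NormedSpace ℝ F]
    {n : ℕ} {U V : Set M} (hU : IsOpen U) (hV : IsOpen V) (hUV : U ⊆ V) {α : MForm 𝓘(ℝ, E) M F n}
    (hα : α.restr V ∈ localExactForms 𝓘(ℝ, E) F hV n) : α.restr U ∈ localExactForms 𝓘(ℝ, E) F hU n := by
  cases n with
  | zero =>
    change α.restr V ∈ (⊥ : Submodule ℝ _) at hα
    change α.restr U ∈ (⊥ : Submodule ℝ _)
    rw [Submodule.mem_bot] at hα ⊢
    have : α.restr U = (α.restr V).restr U := by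
      rw [MForm.restr_restr, inter_eq_left.2 hUV]
    rw [this, hα, MForm.restr_zero]
  | succ n =>
    obtain ⟨g, hg⟩ := (mem_localExactForms_succ_iff hV).1 hα
    rw [mem_localExactForms_succ_iff]
    refine ⟨restrictₗ 𝓘(ℝ, E) F n hU hUV g, ?_⟩
    rw [coe_localD, coe_restrictₗ]
    funext x
    by_cases hx : x ∈ U
    · have := congrFun hg x
      rw [coe_localD, MForm.restr_apply_of_mem _ (hUV hx), MForm.restr_apply_of_mem _ (hUV hx)] at this
      rw [MForm.restr_apply_of_mem _ hx, MForm.restr_apply_of_mem _ hx, mextDeriv_restr_apply hU _ hx]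
      exact this
    · rw [MForm.restr_apply_of_notMem _ hx, MForm.restr_apply_of_notMem _ hx]

/-- A globally exact complex form is exact on every open set. [folklore] -/
theorem restr_mem_localExactForms_of_mem_cexactSmoothForms {n : ℕ} {V : Set M} (hV : IsOpen V)
    {α : MForm 𝓘(ℝ, E) M ℂ n} (hα : α ∈ cexactSmoothForms E M n) :
    α.restr V ∈ localExactForms 𝓘(ℝ, E) ℂ hV n := by
  cases n with
  | zero =>
    change α ∈ (⊥ : Submodule ℂ _) at hα
    change α.restr V ∈ (⊥ : Submodule ℝ _)
    rw [Submodule.mem_bot] at hα ⊢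
    rw [hα, MForm.restr_zero]
  | succ n =>
    obtain ⟨β, hβ, rfl⟩ := (mem_cexactSmoothForms_succ_iff α).1 hα
    rw [mem_localExactForms_succ_iff]
    refine ⟨⟨β.restr V, restr_mem_smoothFormsOn hV (subset_univ V) ⟨fun x _ ↦ hβ x, fun x hx ↦ absurd (mem_univ x) hx⟩⟩, ?_⟩
    rw [coe_localD]
    funext x
    by_cases hx : x ∈ V
    · rw [MForm.restr_apply_of_mem _ hx, MForm.restr_apply_of_mem _ hx]
      exact mextDeriv_restr_apply hV _ hx
    · rw [MForm.restr_apply_of_notMem _ hx, MForm.restr_apply_of_notMem _ hx]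

end LocalExact

/-! ### §2 A globally closed form exact on `V` has zero singular class on `V` -/

section Bridge

variable {E : Type u} [NormedAddCommGroup E] [NormedSpace ℝ E] [FiniteDimensional ℝ E]
  {M : Type u} [TopologicalSpace M] [ChartedSpace E M] [IsManifold 𝓘(ℝ, E) ∞ M]
  [T2Space M] [SecondCountableTopology M] [LocallyCompactSpace M] [SigmaCompactSpace M]

/-- **A globally closed form which is exact on an open `V` has a singular class dying on `V`**:
`(e_M [γ])|_{V} = 0` in `Hⁿ(↥V; ℝ)` (de Rham's theorem on `V`, `localDeRhamToSubset`, natural for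
the restriction from `univ`, and the identification `Θ⁻¹ ∘ comparison = Ψ'` of
`thetaInv_deRhamComparisonIso`). [cite: Bredon1993, Thm. V.9.5] -/
theorem map_subtypeVal_integrationDeRhamIsoFamily_mk_eq_zero {n : ℕ}
    (γ : closedSmoothForms 𝓘(ℝ, E) M ℝ n) {V : Set M} (hV : IsOpen V)
    (hγ : (γ : MForm 𝓘(ℝ, E) M ℝ n).restr V ∈ localExactForms 𝓘(ℝ, E) ℝ hV n) :
    singularCohomology.map ℝ ℝ (⟨Subtype.val, continuous_subtype_val⟩ : C(↥V, M)) n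
      (integrationDeRhamIsoFamily E M n (deRhamCohomology.mk γ)) = 0 := by
  rw [← subsetCochains.resH_thetaInv_eq_zero_iff, integrationDeRhamIsoFamily_apply,
    thetaInv_deRhamComparisonIso, deRhamIsoLocal_mk,
    ← localDeRhamToSubset_res_apply hV isOpen_univ (subset_univ V), homologyMap_homologyCls]
  have h0 : homologyCls ((localDeRhamComplex.res 𝓘(ℝ, E) ℝ hV isOpen_univ (subset_univ V)).f n
      (closedToUniv 𝓘(ℝ, E) M ℝ n γ))
      (d_hom_f_eq_zero _ _ (d_closedToUniv γ)) = 0 := by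
    rw [homologyCls_eq_zero_iff]
    cases n with
    | zero =>
      rw [exists_d_prev_eq_iff symm_down_prev_zero]
      refine ⟨0, ?_⟩
      rw [d_prev_zero_apply]
      change γ.1.restr V ∈ (⊥ : Submodule ℝ _) at hγ
      rw [Submodule.mem_bot] at hγ
      refine (Subtype.ext ?_).symm
      rw [localDeRhamComplex.res_f_apply, coe_restrictₗ]
      exact hγ
    | succ n =>
      obtain ⟨β, hβ⟩ := (mem_localExactForms_succ_iff hV).1 hγ
      rw [exists_d_prev_eq_iff ((ComplexShape.down ℕ).symm.prev_eq' (rfl : n + 1 = n + 1))]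
      refine ⟨β, ?_⟩
      rw [localDeRhamComplex_d]
      refine Subtype.ext ?_
      rw [localDeRhamComplex.res_f_apply, coe_restrictₗ]
      exact hβ
  rw [h0, map_zero]

end Bridge

/-! ### §3 The strata statement -/

section Strata

variable {ι : Type} [LinearOrder ι] [Fintype ι]
  {EM : Type u} [NormedAddCommGroup EM] [NormedSpace ℂ EM] [FiniteDimensional ℂ EM]
  {M : Type u} [TopologicalSpace M] [ChartedSpace EM M] [IsManifold 𝓘(ℝ, EM) ∞ M]
  [IsManifold 𝓘(ℂ, EM) ω M] [CompactSpace M] [T2Space M] [SecondCountableTopology M]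
  [IsKaehlerManifold EM M]
  {EP : Finset ι → Type u} [∀ I, NormedAddCommGroup (EP I)] [∀ I, NormedSpace ℂ (EP I)]
  [∀ I, FiniteDimensional ℂ (EP I)]
  {P : Finset ι → Type u} [∀ I, TopologicalSpace (P I)] [∀ I, ChartedSpace (EP I) (P I)]
  [∀ I, IsManifold 𝓘(ℝ, EP I) ∞ (P I)] [∀ I, IsManifold 𝓘(ℂ, EP I) ω (P I)]
  [∀ I, CompactSpace (P I)] [∀ I, T2Space (P I)] [∀ I, SecondCountableTopology (P I)]
  [∀ I, IsKaehlerManifold (EP I) (P I)]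
  (T : StrataMaps (EM := EM) M EP P) (hinj : ∀ I : Finset ι, Injective (T.emb I))
  (hrange : ∀ I : Finset ι, I.Nonempty → range (T.emb I) = ⋂ i ∈ I, range (T.emb {i}))

namespace StrataMaps

omit [Fintype ι] [FiniteDimensional ℂ EM] [IsManifold 𝓘(ℝ, EM) ∞ M] [IsManifold 𝓘(ℂ, EM) ω M]
  [CompactSpace M] [T2Space M] [SecondCountableTopology M] [IsKaehlerManifold EM M]
  [∀ I, CompactSpace (P I)] [∀ I, T2Space (P I)] [∀ I, SecondCountableTopology (P I)]
  [∀ I, IsKaehlerManifold (EP I) (P I)] [∀ I, FiniteDimensional ℂ (EP I)]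
  [∀ I, IsManifold 𝓘(ℝ, EP I) ∞ (P I)] [∀ I, IsManifold 𝓘(ℂ, EP I) ω (P I)] in
/-- The restriction to the stratum of a `1`-tuple `J` factors through the stratum `P {J 0}`.
[folklore] -/
theorem sres_eq_pullback_res {n : ℕ} (ω' : MForm 𝓘(ℝ, EM) M ℂ n) (J : Fin 1 → ι) :
    T.sres ω' J = (ω'.pullback 𝓘(ℝ, EP {J 0}) (T.emb {J 0})).pullback 𝓘(ℝ, EP (tupleSupport J))
      (T.res (singleton_subset_tupleSupport J 0)) := by
  rw [MForm.pullback_pullback_of_mdifferentiable _ ((T.contMDiff_emb _).mdifferentiable (by simp))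
    ((T.contMDiff_res _).mdifferentiable (by simp)), T.emb_comp_res]
  rfl

omit [IsManifold 𝓘(ℂ, EM) ω M] [IsKaehlerManifold EM M] in
include hinj hrange in
/-- **Per type.** A closed form of pure type `(p, q)` on `M` whose pull-backs to the strata
`P {i}` are exact is exact on an open neighbourhood of `⋃ i, emb(P {i})`: types `p, q ≥ 1` by the
`∂∂̄`-descent (`exists_nhd_restr_mem_localExactForms_of_isOfType`); for `p = 0` or `q = 0` the
pull-backs vanish (an exact form of type `(0, q)` / `(p, 0)` on a compact Kähler manifold is `0`,
Voisin (2002), Prop. 6.17) and the zero tower applies. [cite: DeligneGriffithsMorganSullivan1975, §§5–6]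
[cite: VoisinHodgeI2002, Prop. 6.17] -/
theorem exists_nhd_restr_mem_localExactForms_of_pullback_mem_cexact {n : ℕ} {ω' : MForm 𝓘(ℝ, EM) M ℂ n}
    (hωs : IsSmoothForm ω') (hωc : IsClosedForm ω') {p q : ℕ} (hωt : IsOfType p q ω')
    (hex : ∀ i, ω'.pullback 𝓘(ℝ, EP {i}) (T.emb {i}) ∈ cexactSmoothForms (EP {i}) (P {i}) n) :
    ∃ (V : Set M) (hV : IsOpen V), (∀ i, range (T.emb {i}) ⊆ V) ∧
      ω'.restr V ∈ localExactForms 𝓘(ℝ, EM) ℂ hV n := by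
  have hpq : p + q = n := hωt.1
  -- the pull-backs to the `P {i}`, smooth and of type `(p, q)`
  have hsm : ∀ i, IsSmoothForm (ω'.pullback 𝓘(ℝ, EP {i}) (T.emb {i})) := fun i ↦
    isSmoothForm_pullback (T.contMDiff_emb _) hωs
  have hty : ∀ i, IsOfType p q (ω'.pullback 𝓘(ℝ, EP {i}) (T.emb {i})) := fun i ↦
    hωt.pullback (T.mdifferentiable_emb _)
  cases n with
  | zero =>
    -- degree `0`: exact forms vanish
    have h0 : ∀ J : Fin 1 → ι, T.sres ω' J = 0 := fun J ↦ by
      have : ω'.pullback 𝓘(ℝ, EP {J 0}) (T.emb {J 0}) = 0 := by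
        have h := hex (J 0)
        change _ ∈ (⊥ : Submodule ℂ _) at h
        exact (Submodule.mem_bot ℂ).1 h
      rw [T.sres_eq_pullback_res ω' J, this, MForm.pullback_zero]
    obtain ⟨V, hVo, hKV, hV0⟩ := T.exists_nhd_restr_eq_zero_of_sres_eq_zero hinj hrange hωs hωc h0
    refine ⟨V, hVo, hKV, ?_⟩
    change ω'.restr V ∈ (⊥ : Submodule ℝ _)
    rw [hV0]
    exact zero_mem _
  | succ m =>
    -- the primitives on the `P {i}`
    have hprim : ∀ i, ∃ α : MForm 𝓘(ℝ, EP {i}) (P {i}) ℂ m, IsSmoothForm α ∧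
        ω'.pullback 𝓘(ℝ, EP {i}) (T.emb {i}) = mextDeriv α := fun i ↦
      (mem_cexactSmoothForms_succ_iff _).1 (hex i)
    rcases p with - | p'
    · -- type `(0, m+1)`: the pull-backs vanish
      obtain rfl : q = m + 1 := by omega
      have h0 : ∀ J : Fin 1 → ι, T.sres ω' J = 0 := fun J ↦ by
        obtain ⟨α, hα, he⟩ := hprim (J 0)
        rw [T.sres_eq_pullback_res ω' J,
          eq_zero_of_exact_of_isOfType_zero_left (hsm (J 0)) (hty (J 0)) hα he, MForm.pullback_zero]
      obtain ⟨V, hVo, hKV, hVex⟩ :=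
        T.exists_nhd_restr_mem_localExactForms_of_sres_eq_zero hinj hrange hωs hωc h0
      exact ⟨V, hVo, hKV, hVex⟩
    rcases q with - | q'
    · -- type `(p'+1, 0)`: the pull-backs vanish
      have h0 : ∀ J : Fin 1 → ι, T.sres ω' J = 0 := fun J ↦ by
        obtain ⟨α, hα, he⟩ := hprim (J 0)
        rw [T.sres_eq_pullback_res ω' J,
          eq_zero_of_exact_of_isOfType_zero_right (hsm (J 0)) (hty (J 0)) hα he, MForm.pullback_zero]
      obtain ⟨V, hVo, hKV, hVex⟩ :=
        T.exists_nhd_restr_mem_localExactForms_of_sres_eq_zero hinj hrange hωs hωc h0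
      exact ⟨V, hVo, hKV, hVex⟩
    -- type `(p'+1, q'+1)`: the `∂∂̄`-descent
    obtain ⟨k, hk⟩ : ∃ k, m = k + 1 := ⟨p' + q', by omega⟩
    subst hk
    have hx : ∀ J : Fin 1 → ι, ∃ α : MForm 𝓘(ℝ, EP (tupleSupport J)) (P (tupleSupport J)) ℂ (k + 1),
        IsSmoothForm α ∧ T.sres ω' J = mextDeriv α := fun J ↦ by
      obtain ⟨α, hα, he⟩ := hprim (J 0)
      refine ⟨α.pullback 𝓘(ℝ, EP (tupleSupport J)) (T.res (singleton_subset_tupleSupport J 0)),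
        isSmoothForm_pullback (T.contMDiff_res _) hα, ?_⟩
      rw [T.sres_eq_pullback_res ω' J, he, mextDeriv_pullback (T.contMDiff_res _) hα]
    exact T.exists_nhd_restr_mem_localExactForms_of_isOfType hinj hrange hωs hωt hx hωc

omit [LinearOrder ι] [Fintype ι] [FiniteDimensional ℂ EM] [IsManifold 𝓘(ℂ, EM) ω M] [CompactSpace M]
  [T2Space M] [SecondCountableTopology M] [IsKaehlerManifold EM M] [∀ I, IsManifold 𝓘(ℂ, EP I) ω (P I)]
  [∀ I, CompactSpace (P I)] [∀ I, T2Space (P I)] [∀ I, SecondCountableTopology (P I)]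
  [∀ I, IsKaehlerManifold (EP I) (P I)] [∀ I, FiniteDimensional ℂ (EP I)] in
/-- In an independent family of submodules, a finite sum of members vanishes only if every
summand does. [folklore] -/
theorem eq_zero_of_sum_eq_zero_of_iSupIndep {R N : Type*} [Ring R] [AddCommGroup N] [Module R N]
    {κ : Type*} {S : κ → Submodule R N} (hS : iSupIndep S) (s : Finset κ) {x : κ → N}
    (hx : ∀ j ∈ s, x j ∈ S j) (h0 : ∑ j ∈ s, x j = 0) : ∀ j ∈ s, x j = 0 := by
  classical
  intro j hj
  have hdisj := hS j
  have hxj : x j = -∑ l ∈ s.erase j, x l := by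
    rw [← Finset.add_sum_erase s x hj] at h0
    exact eq_neg_of_add_eq_zero_left h0
  have hmem : x j ∈ ⨆ l ≠ j, S l := by
    rw [hxj]
    refine Submodule.neg_mem _ (Submodule.sum_mem _ fun l hl ↦ ?_)
    exact Submodule.mem_iSup_of_mem l (Submodule.mem_iSup_of_mem (Finset.ne_of_mem_erase hl) (hx l (Finset.mem_of_mem_erase hl)))
  exact (Submodule.disjoint_def.1 hdisj) _ (hx j hj) hmem

include hinj hrange in
/-- **Real classes dying on the strata die near their union** (Deligne, Hodge III, Prop. 8.2.7 /
Cor. 8.2.8, compact Kähler form; proof by the principle of two types). For an embedded strata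
system with compact Kähler strata in a compact Kähler manifold `M` (higher strata =
intersections) and `a ∈ Hⁿ(M; ℝ)` with `emb_i^* a = 0` for all `i`, there is an open
`V ⊇ ⋃ i, emb(P {i})` with `a|_V = 0` in `Hⁿ(↥V; ℝ)`. [cite: DeligneHodgeIII1974, Prop. 8.2.7]
[cite: DeligneGriffithsMorganSullivan1975, §§5–6] [cite: VoisinHodgeI2002, §6.1.3] -/
theorem exists_isOpen_map_subtypeVal_eq_zero_real {n : ℕ} (a : singularCohomology ℝ ℝ M n)
    (ha : ∀ i, singularCohomology.map ℝ ℝ ⟨T.emb {i}, (T.contMDiff_emb {i}).continuous⟩ n a = 0) :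
    ∃ V : Set M, IsOpen V ∧ (∀ i, range (T.emb {i}) ⊆ V) ∧
      singularCohomology.map ℝ ℝ (⟨Subtype.val, continuous_subtype_val⟩ : C(↥V, M)) n a = 0 := by
  haveI : FiniteDimensional ℝ EM := FiniteDimensional.complexToReal EM
  haveI : ∀ I, FiniteDimensional ℝ (EP I) := fun I ↦ FiniteDimensional.complexToReal (EP I)
  haveI : LocallyCompactSpace M := locallyCompactSpace_of_chartedSpace EM M
  haveI : ∀ I, LocallyCompactSpace (P I) := fun I ↦ locallyCompactSpace_of_chartedSpace (EP I) (P I)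
  -- de Rham
  obtain ⟨c, rfl⟩ := (integrationDeRhamIsoFamily EM M n).surjective a
  obtain ⟨γ, rfl⟩ := deRhamCohomology.mk_surjective c
  have hγex : ∀ i, (γ : MForm 𝓘(ℝ, EM) M ℝ n).pullback 𝓘(ℝ, EP {i}) (T.emb {i}) ∈
      exactSmoothForms 𝓘(ℝ, EP {i}) (P {i}) ℝ n := by
    intro i
    refine mem_exactSmoothForms_of_mk_eq_zero ⟨_, pullback_mem_closedSmoothForms (T.contMDiff_emb {i}) γ.2⟩ ?_
    rw [← deRhamCohomology.map_mk (T.contMDiff_emb {i})]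
    apply (integrationDeRhamIsoFamily (EP {i}) (P {i}) n).injective
    rw [map_zero, integrationDeRhamIsoFamily_map_of_contMDiff (T.contMDiff_emb {i}) n, ha i]
  -- complexify and Hodge-decompose on `M`
  set γc : MForm 𝓘(ℝ, EM) M ℂ n := (γ : MForm 𝓘(ℝ, EM) M ℝ n).ofReal with hγcdef
  have hγcs : IsSmoothForm γc := γ.2.1.ofReal
  have hγcc : IsClosedForm γc := by
    rw [IsClosedForm, hγcdef, MForm.mextDeriv_ofReal_holds, show mextDeriv (γ : MForm 𝓘(ℝ, EM) M ℝ n) = 0 from γ.2.2]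
    funext x; ext v; simp
  have hγcm : γc ∈ cclosedSmoothForms EM M n := (mem_cclosedSmoothForms_iff _).2 ⟨hγcs, hγcc⟩
  have htop : complexDeRhamCohomology.mk EM M n ⟨γc, hγcm⟩ ∈
      ⨆ pq ∈ Finset.HasAntidiagonal.antidiagonal n, hodgePQ EM M n pq.1 pq.2 := by
    rw [Literature.AlgebraicGeometry.Motives.iSup_hodgePQ_eq_top
      Literature.AlgebraicGeometry.Motives.isInternal_hodgePQ_holds n]
    exact Submodule.mem_top
  obtain ⟨μ, hμ⟩ := (Submodule.mem_iSup_finset_iff_exists_sum _ _).1 htop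
  have hrep : ∀ pq ∈ Finset.HasAntidiagonal.antidiagonal n, ∃ ω' : cclosedSmoothForms EM M n,
      IsOfType pq.1 pq.2 (ω' : MForm 𝓘(ℝ, EM) M ℂ n) ∧ complexDeRhamCohomology.mk EM M n ω' = μ pq :=
    fun pq hpq ↦ Literature.AlgebraicGeometry.Motives.exists_isOfType_mk_eq_of_mem_hodgePQ
      (Finset.HasAntidiagonal.mem_antidiagonal.1 hpq) (μ pq).2
  choose! ω' hωt hωμ using hrep
  -- `γ ⊗ 1 - Σ ω_{p,q}` is exact
  have hdiff : γc - ∑ pq ∈ Finset.HasAntidiagonal.antidiagonal n, (ω' pq : MForm 𝓘(ℝ, EM) M ℂ n) ∈ cexactSmoothForms EM M n := by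
    have heq : complexDeRhamCohomology.mk EM M n ⟨γc, hγcm⟩ =
        complexDeRhamCohomology.mk EM M n (∑ pq ∈ Finset.HasAntidiagonal.antidiagonal n, ω' pq) := by
      rw [map_sum, ← hμ]
      exact Finset.sum_congr rfl fun pq hpq ↦ (hωμ pq hpq).symm
    have := (complexDeRhamCohomology.mk_eq_mk_iff _ _).1 heq
    simpa only [Submodule.coe_sum] using this
  -- each `ω_{p,q}` pulls back to an exact form on every `P {i}`
  have hωex : ∀ pq ∈ Finset.HasAntidiagonal.antidiagonal n, ∀ i,
      (ω' pq : MForm 𝓘(ℝ, EM) M ℂ n).pullback 𝓘(ℝ, EP {i}) (T.emb {i}) ∈ cexactSmoothForms (EP {i}) (P {i}) n := by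
    intro pq hpq i
    -- the pulled-back decomposition on `P {i}`
    have hfi := T.contMDiff_emb {i}
    set ρ : (ℕ × ℕ) → MForm 𝓘(ℝ, EP {i}) (P {i}) ℂ n :=
      fun rs ↦ (ω' rs : MForm 𝓘(ℝ, EM) M ℂ n).pullback 𝓘(ℝ, EP {i}) (T.emb {i}) with hρ
    have hρm : ∀ rs ∈ Finset.HasAntidiagonal.antidiagonal n, ρ rs ∈ cclosedSmoothForms (EP {i}) (P {i}) n := fun rs hrs ↦ by
      have h2 := (mem_cclosedSmoothForms_iff _).1 (ω' rs).2
      exact (mem_cclosedSmoothForms_iff _).2 (pullback_mem_closedSmoothForms hfi ⟨h2.1, h2.2⟩)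
    -- the sum of the `ρ rs` is exact: `Σ ρ = emb^* (γ ⊗ 1) - emb^*(exact)`
    have hsum : ∑ rs ∈ Finset.HasAntidiagonal.antidiagonal n, ρ rs ∈ cexactSmoothForms (EP {i}) (P {i}) n := by
      have h1 : γc.pullback 𝓘(ℝ, EP {i}) (T.emb {i}) ∈ cexactSmoothForms (EP {i}) (P {i}) n := by
        rw [hγcdef, ← MForm.ofReal_pullback]
        -- real exact ⟹ complex exact (`exactSmoothForms … ℂ` is the real structure of `cexactSmoothForms`)
        have : ((γ : MForm 𝓘(ℝ, EM) M ℝ n).pullback 𝓘(ℝ, EP {i}) (T.emb {i})).ofReal ∈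
            exactSmoothForms 𝓘(ℝ, EP {i}) (P {i}) ℂ n := by
          cases n with
          | zero =>
            have h0 : (γ : MForm 𝓘(ℝ, EM) M ℝ 0).pullback 𝓘(ℝ, EP {i}) (T.emb {i}) = 0 := by
              simpa [exactSmoothForms] using hγex i
            rw [h0]
            have : (0 : MForm 𝓘(ℝ, EP {i}) (P {i}) ℝ 0).ofReal = 0 := by funext x; ext v; simp
            rw [this]
            exact zero_mem _
          | succ n =>
            obtain ⟨β, hβ, hβe⟩ := exists_eq_mextDeriv_of_mem_exactSmoothForms (hγex i)
            rw [← hβe, ← MForm.mextDeriv_ofReal_holds]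
            exact Submodule.subset_span ⟨β.ofReal, hβ.ofReal, rfl⟩
        rw [← restrictScalars_cexactSmoothForms_holds] at this
        exact this
      have h2 : (γc - ∑ pq ∈ Finset.HasAntidiagonal.antidiagonal n, (ω' pq : MForm 𝓘(ℝ, EM) M ℂ n)).pullback
          𝓘(ℝ, EP {i}) (T.emb {i}) ∈ cexactSmoothForms (EP {i}) (P {i}) n := by
        have := pullback_mem_exactSmoothForms hfi
          ((restrictScalars_cexactSmoothForms_holds (E := EM) (M := M) n) ▸
            (Submodule.restrictScalars_mem ℝ _ _).2 hdiff :
            γc - ∑ pq ∈ Finset.HasAntidiagonal.antidiagonal n, (ω' pq : MForm 𝓘(ℝ, EM) M ℂ n) ∈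
              exactSmoothForms 𝓘(ℝ, EM) M ℂ n)
        rw [← restrictScalars_cexactSmoothForms_holds] at this
        exact this
      have h3 : ∑ rs ∈ Finset.HasAntidiagonal.antidiagonal n, ρ rs = γc.pullback 𝓘(ℝ, EP {i}) (T.emb {i}) -
          (γc - ∑ pq ∈ Finset.HasAntidiagonal.antidiagonal n, (ω' pq : MForm 𝓘(ℝ, EM) M ℂ n)).pullback
            𝓘(ℝ, EP {i}) (T.emb {i}) := by
        rw [mform_pullback_sub, sub_sub_cancel, hρ]
        simp only
        induction (Finset.HasAntidiagonal.antidiagonal n) using Finset.induction_on with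
        | empty => simp [MForm.pullback_zero]
        | insert a s ha ih => rw [Finset.sum_insert ha, Finset.sum_insert ha, MForm.pullback_add, ih]
      rw [h3]
      exact Submodule.sub_mem _ h1 h2
    -- in cohomology: `Σ [ρ rs] = 0`, the `[ρ rs]` in independent Hodge pieces
    set S : ↥(Finset.HasAntidiagonal.antidiagonal n) → Submodule ℂ (complexDeRhamCohomology (EP {i}) (P {i}) n) :=
      fun rs ↦ hodgePQ (EP {i}) (P {i}) n rs.1.1 rs.1.2 with hS
    have hind : iSupIndep S :=
      (Literature.AlgebraicGeometry.Motives.directSum_isInternal_hodgePQ (E := EP {i}) (M := P {i}) n).submodule_iSupIndep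
    set xcls : ↥(Finset.HasAntidiagonal.antidiagonal n) → complexDeRhamCohomology (EP {i}) (P {i}) n :=
      fun rs ↦ complexDeRhamCohomology.mk (EP {i}) (P {i}) n ⟨ρ rs.1, hρm rs.1 rs.2⟩ with hxcls
    have hxmem : ∀ rs ∈ (Finset.univ : Finset ↥(Finset.HasAntidiagonal.antidiagonal n)), xcls rs ∈ S rs := fun rs _ ↦
      Submodule.subset_span ⟨⟨ρ rs.1, hρm rs.1 rs.2⟩, (hωt rs.1 rs.2).pullback (T.mdifferentiable_emb _), rfl⟩
    have hx0 : ∑ rs ∈ (Finset.univ : Finset ↥(Finset.HasAntidiagonal.antidiagonal n)), xcls rs = 0 := by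
      have : ∑ rs ∈ (Finset.univ : Finset ↥(Finset.HasAntidiagonal.antidiagonal n)), xcls rs =
          complexDeRhamCohomology.mk (EP {i}) (P {i}) n
            ⟨∑ rs ∈ Finset.HasAntidiagonal.antidiagonal n, ρ rs, Submodule.sum_mem _ hρm⟩ := by
        rw [hxcls]
        simp only
        rw [← map_sum]
        congr 1
        apply Subtype.ext
        rw [Submodule.coe_sum]
        exact (Finset.sum_coe_sort (Finset.HasAntidiagonal.antidiagonal n) (fun rs ↦ ρ rs))
      rw [this]
      have h0 : complexDeRhamCohomology.mk (EP {i}) (P {i}) n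
          ⟨∑ rs ∈ Finset.HasAntidiagonal.antidiagonal n, ρ rs, Submodule.sum_mem _ hρm⟩ =
          complexDeRhamCohomology.mk (EP {i}) (P {i}) n 0 := by
        rw [complexDeRhamCohomology.mk_eq_mk_iff]
        simpa using hsum
      rw [h0, map_zero]
    have hall := eq_zero_of_sum_eq_zero_of_iSupIndep hind Finset.univ hxmem hx0
      ⟨pq, hpq⟩ (Finset.mem_univ _)
    -- `[ρ pq] = 0` ⟹ `ρ pq` exact
    have : complexDeRhamCohomology.mk (EP {i}) (P {i}) n ⟨ρ pq, hρm pq hpq⟩ =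
        complexDeRhamCohomology.mk (EP {i}) (P {i}) n 0 := by rw [map_zero]; exact hall
    have h4 := (complexDeRhamCohomology.mk_eq_mk_iff _ _).1 this
    simpa using h4
  -- per type: local exactness of every `ω_{p,q}` near the union
  have hloc : ∀ pq ∈ Finset.HasAntidiagonal.antidiagonal n, ∃ (V : Set M) (hV : IsOpen V), (∀ i, range (T.emb {i}) ⊆ V) ∧
      (ω' pq : MForm 𝓘(ℝ, EM) M ℂ n).restr V ∈ localExactForms 𝓘(ℝ, EM) ℂ hV n := fun pq hpq ↦ by
    have h2 := (mem_cclosedSmoothForms_iff _).1 (ω' pq).2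
    exact T.exists_nhd_restr_mem_localExactForms_of_pullback_mem_cexact hinj hrange h2.1 h2.2
      (hωt pq hpq) (hωex pq hpq)
  choose! V hVo hKV hVex using hloc
  set W : Set M := ⋂ pq ∈ Finset.HasAntidiagonal.antidiagonal n, V pq with hW
  have hWo : IsOpen W := isOpen_biInter_finset fun pq hpq ↦ hVo pq hpq
  have hWV : ∀ pq ∈ Finset.HasAntidiagonal.antidiagonal n, W ⊆ V pq := fun pq hpq ↦ biInter_subset_of_mem hpq
  refine ⟨W, hWo, fun i ↦ subset_iInter₂ fun pq hpq ↦ hKV pq hpq i, ?_⟩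
  -- `γ ⊗ 1` is exact on `W`, hence so is `γ`
  have hγcW : γc.restr W ∈ localExactForms 𝓘(ℝ, EM) ℂ hWo n := by
    have e : γc.restr W = (γc - ∑ pq ∈ Finset.HasAntidiagonal.antidiagonal n, (ω' pq : MForm 𝓘(ℝ, EM) M ℂ n)).restr W +
        ∑ pq ∈ Finset.HasAntidiagonal.antidiagonal n, (ω' pq : MForm 𝓘(ℝ, EM) M ℂ n).restr W := by
      rw [MForm.restr_sub, ← MForm.restr_sum, sub_add_cancel]
    rw [e]
    refine add_mem (restr_mem_localExactForms_of_mem_cexactSmoothForms hWo hdiff)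
      (Submodule.sum_mem _ fun pq hpq ↦ ?_)
    exact restr_mem_localExactForms_of_subset hWo (hVo pq hpq) (hWV pq hpq) (hVex pq hpq)
  have hγW : (γ : MForm 𝓘(ℝ, EM) M ℝ n).restr W ∈ localExactForms 𝓘(ℝ, EM) ℝ hWo n := by
    have : (γ : MForm 𝓘(ℝ, EM) M ℝ n).restr W = (γc.restr W).re := by
      rw [MForm.re_restr, hγcdef, MForm.re_ofReal]
    rw [this]
    exact re_mem_localExactForms hWo hγcW
  exact map_subtypeVal_integrationDeRhamIsoFamily_mk_eq_zero γ hWo hγW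

include hinj hrange in
/-- **Complex classes dying on the strata die near their union** (Deligne, Hodge III,
Prop. 8.2.7 / Cor. 8.2.8, compact Kähler form): for `u ∈ Hⁿ(M; ℂ)` with `emb_i^* u = 0` for all
`i` there is an open `V ⊇ ⋃ i, emb(P {i})` with `u|_V = 0` in `Hⁿ(↥V; ℂ)` (real and imaginary
parts, `RealStructureSingular`). [cite: DeligneHodgeIII1974, Prop. 8.2.7]
[cite: DeligneGriffithsMorganSullivan1975, §§5–6] -/
theorem exists_isOpen_map_subtypeVal_eq_zero_complex {n : ℕ} (u : singularCohomology ℂ ℂ M n)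
    (hu : ∀ i, singularCohomology.map ℂ ℂ ⟨T.emb {i}, (T.contMDiff_emb {i}).continuous⟩ n u = 0) :
    ∃ V : Set M, IsOpen V ∧ (∀ i, range (T.emb {i}) ⊆ V) ∧
      singularCohomology.map ℂ ℂ (⟨Subtype.val, continuous_subtype_val⟩ : C(↥V, M)) n u = 0 := by
  open Literature.AlgebraicGeometry.HodgeTheory in
  have hre : ∀ i, singularCohomology.map ℝ ℝ ⟨T.emb {i}, (T.contMDiff_emb {i}).continuous⟩ n
      (reClass M n u) = 0 := fun i ↦ by rw [← reClass_map, hu i, map_zero]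
  open Literature.AlgebraicGeometry.HodgeTheory in
  have him : ∀ i, singularCohomology.map ℝ ℝ ⟨T.emb {i}, (T.contMDiff_emb {i}).continuous⟩ n
      (imClass M n u) = 0 := fun i ↦ by rw [← imClass_map, hu i, map_zero]
  obtain ⟨V₁, hV₁, hK₁, h₁⟩ := T.exists_isOpen_map_subtypeVal_eq_zero_real hinj hrange _ hre
  obtain ⟨V₂, hV₂, hK₂, h₂⟩ := T.exists_isOpen_map_subtypeVal_eq_zero_real hinj hrange _ him
  refine ⟨V₁ ∩ V₂, hV₁.inter hV₂, fun i ↦ subset_inter (hK₁ i) (hK₂ i), ?_⟩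
  -- restrict further to `V₁ ∩ V₂`
  have hres : ∀ {W : Set M} (hW : V₁ ∩ V₂ ⊆ W) (b : singularCohomology ℝ ℝ M n),
      singularCohomology.map ℝ ℝ (⟨Subtype.val, continuous_subtype_val⟩ : C(↥W, M)) n b = 0 →
      singularCohomology.map ℝ ℝ (⟨Subtype.val, continuous_subtype_val⟩ : C(↥(V₁ ∩ V₂), M)) n b = 0 := by
    intro W hW b hb
    have e : (⟨Subtype.val, continuous_subtype_val⟩ : C(↥(V₁ ∩ V₂), M)) =
        (⟨Subtype.val, continuous_subtype_val⟩ : C(↥W, M)).comp (ContinuousMap.inclusion hW) := rfl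
    rw [e, singularCohomology.map_comp, ModuleCat.comp_apply, hb, map_zero]
  have h₁' := hres inter_subset_left _ h₁
  have h₂' := hres inter_subset_right _ h₂
  open Literature.AlgebraicGeometry.HodgeTheory in
  rw [← ofRealClass_reClass_add_I_smul u, map_add, map_smul, ← ofRealClass_map, ← ofRealClass_map,
    h₁', h₂']
  simp

end StrataMaps

end Strata

end Literature.Geometry.Kaehler
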